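import Mathlib
import HarnessLib

/-!
# Integral positive-definiteness of exponential inner-product kernels

Topic `Literature/Analysis/OperatorTheory` (companion of `PositiveKernelTransferOperator.lean`): the
operator positivity of transfer kernels of the form `k(x, y) = exp(β ⟨v(x), v(y)⟩)` — e.g. the Wilson
slice kernel of lattice gauge theory, `exp(β Re tr(ρ(U)* ρ(W)))` with the real feature map `v = ρ` read
in real coordinates — in the integral sense.  For a finite measure `μ`, a bounded measurable
`v : X → ℝᵖ`, `β ≥ 0` and a bounded measurable `f`,

  `0 ≤ ∫ f(x) exp(β Σⱼ vⱼ(x) vⱼ(y)) f(y) d(μ ⊗ μ)(x, y)`,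

by the explicit feature expansion `exp(β s) = Σₙ (β s)ⁿ/n!`, `(Σⱼ aⱼ bⱼ)ⁿ = Σ_{i : Fin n → Fin p} (∏ₖ a_{iₖ})(∏ₖ b_{iₖ})`,
so that the double integral is `Σₙ βⁿ/n! Σᵢ (∫ f Aᵢ)² ≥ 0` (dominated convergence for series).  `[folklore]`
-/

noncomputable section

open MeasureTheory Finset
open scoped BigOperators

namespace Literature.Analysis.OperatorTheory

/-- `(Σⱼ aⱼ bⱼ)ⁿ = Σ_{i : Fin n → Fin p} (∏ₖ a (i k)) (∏ₖ b (i k))`. [folklore] -/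
theorem sum_mul_pow_eq_sum_prod {p : ℕ} (a b : Fin p → ℝ) (n : ℕ) :
    (∑ j, a j * b j) ^ n = ∑ i : Fin n → Fin p, (∏ k, a (i k)) * ∏ k, b (i k) := by
  rw [Finset.sum_pow', Fintype.piFinset_univ]
  exact Finset.sum_congr rfl fun i _ => Finset.prod_mul_distrib

variable {X : Type*} [MeasurableSpace X] (μ : Measure X) [IsFiniteMeasure μ]

/-- **Integral positive-definiteness of `exp(β ⟨v(x), v(y)⟩)`** for a bounded measurable real feature map
`v : X → ℝᵖ`, `β ≥ 0`, against a bounded measurable `f`, on the product of a finite measure with itself: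
`0 ≤ ∫ f(x) e^{β Σⱼ vⱼ(x) vⱼ(y)} f(y) d(μ ⊗ μ)`. [folklore] -/
theorem integral_mul_exp_sum_mul_mul_nonneg {p : ℕ} (v : X → Fin p → ℝ)
    (hv : ∀ j, Measurable fun x => v x j) (M : ℝ) (hM : ∀ x j, |v x j| ≤ M)
    (β : ℝ) (hβ : 0 ≤ β) (f : X → ℝ) (hf : Measurable f) (C : ℝ) (hC : ∀ x, |f x| ≤ C) :
    0 ≤ ∫ z, f z.1 * Real.exp (β * ∑ j, v z.1 j * v z.2 j) * f z.2 ∂(μ.prod μ) := by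
  -- notation: the inner product `s`, the features `A i`, the terms `F n` of the series
  set s : X × X → ℝ := fun z => ∑ j, v z.1 j * v z.2 j with hs
  set F : ℕ → X × X → ℝ := fun n z => f z.1 * f z.2 * ((β * s z) ^ n / (n.factorial : ℝ)) with hF
  -- measurability
  have hs_meas : Measurable s :=
    Finset.measurable_sum _ fun j _ => ((hv j).comp measurable_fst).mul ((hv j).comp measurable_snd)
  have hA_meas : ∀ {n : ℕ} (i : Fin n → Fin p), Measurable fun x => ∏ k, v x (i k) := fun i =>
    Finset.measurable_prod _ fun k _ => hv (i k)
  have hff_meas : Measurable fun z : X × X => f z.1 * f z.2 :=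
    (hf.comp measurable_fst).mul (hf.comp measurable_snd)
  have hF_meas : ∀ n, AEStronglyMeasurable (F n) (μ.prod μ) := fun n =>
    (hff_meas.mul ((hs_meas.const_mul β).pow_const n |>.div_const _)).aestronglyMeasurable
  -- pointwise bounds
  have hsB : ∀ z, |s z| ≤ p * M ^ 2 := fun z => by
    calc |s z| ≤ ∑ j, |v z.1 j * v z.2 j| := Finset.abs_sum_le_sum_abs _ _
      _ ≤ ∑ _j : Fin p, M ^ 2 := Finset.sum_le_sum fun j _ => by
          rw [abs_mul, sq]
          exact mul_le_mul (hM _ _) (hM _ _) (abs_nonneg _) ((abs_nonneg (v z.1 j)).trans (hM z.1 j))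
      _ = p * M ^ 2 := by simp
  have hffB : ∀ z : X × X, |f z.1 * f z.2| ≤ C * C := fun z => by
    rw [abs_mul]
    exact mul_le_mul (hC _) (hC _) (abs_nonneg _) ((abs_nonneg (f z.1)).trans (hC z.1))
  have hAB : ∀ {n : ℕ} (i : Fin n → Fin p) (x : X), |∏ k, v x (i k)| ≤ M ^ n := fun {n} i x => by
    rw [Finset.abs_prod]
    calc ∏ k, |v x (i k)| ≤ ∏ _k : Fin n, M :=
          Finset.prod_le_prod (fun _ _ => abs_nonneg _) fun k _ => hM _ _
      _ = M ^ n := by simp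
  -- the dominating series
  set b : ℕ → ℝ := fun n => C * C * ((β * (p * M ^ 2)) ^ n / (n.factorial : ℝ)) with hb
  have hb_sum : Summable b := (Real.summable_pow_div_factorial _).mul_left _
  have h_bound : ∀ n, ∀ᵐ z ∂(μ.prod μ), ‖F n z‖ ≤ b n := fun n => ae_of_all _ fun z => by
    rw [Real.norm_eq_abs]
    show |f z.1 * f z.2 * ((β * s z) ^ n / (n.factorial : ℝ))| ≤ C * C * ((β * (p * M ^ 2)) ^ n / n.factorial)
    rw [abs_mul, abs_div, abs_pow, Nat.abs_cast]
    refine mul_le_mul (hffB z) ?_ (by positivity) ((abs_nonneg _).trans (hffB z))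
    refine div_le_div_of_nonneg_right ?_ (by positivity)
    refine pow_le_pow_left₀ (abs_nonneg _) ?_ n
    rw [abs_mul, abs_of_nonneg hβ]
    exact mul_le_mul_of_nonneg_left (hsB z) hβ
  -- the series converges pointwise to the integrand
  have h_lim : ∀ᵐ z ∂(μ.prod μ), HasSum (fun n => F n z) (f z.1 * Real.exp (β * s z) * f z.2) :=
    ae_of_all _ fun z => by
      have h := NormedSpace.expSeries_div_hasSum_exp (β * s z)
      rw [← Real.exp_eq_exp_ℝ] at h
      have h2 := h.mul_left (f z.1 * f z.2)
      have e3 : f z.1 * Real.exp (β * s z) * f z.2 = f z.1 * f z.2 * Real.exp (β * s z) := by ring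
      rw [e3]
      exact h2
  have hsum := hasSum_integral_of_dominated_convergence (fun n _ => b n) hF_meas h_bound
    (ae_of_all _ fun _ => hb_sum) (integrable_const _) h_lim
  -- each term of the series has a nonnegative integral: `∫ F n = βⁿ/n! Σᵢ (∫ f Aᵢ)²`
  have hFn : ∀ n, 0 ≤ ∫ z, F n z ∂(μ.prod μ) := fun n => by
    have e : ∀ z, F n z = (β ^ n / (n.factorial : ℝ)) *
        ∑ i : Fin n → Fin p, (f z.1 * ∏ k, v z.1 (i k)) * (f z.2 * ∏ k, v z.2 (i k)) := fun z => by
      show f z.1 * f z.2 * ((β * s z) ^ n / (n.factorial : ℝ)) = _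
      rw [mul_pow, show s z ^ n = ∑ i : Fin n → Fin p, (∏ k, v z.1 (i k)) * ∏ k, v z.2 (i k) from
        sum_mul_pow_eq_sum_prod _ _ n, Finset.mul_sum, Finset.sum_div, Finset.mul_sum, Finset.mul_sum]
      refine Finset.sum_congr rfl fun i _ => ?_
      ring
    simp_rw [e]
    rw [integral_const_mul]
    refine mul_nonneg (by positivity) ?_
    have hint : ∀ i : Fin n → Fin p,
        Integrable (fun z : X × X => (f z.1 * ∏ k, v z.1 (i k)) * (f z.2 * ∏ k, v z.2 (i k))) (μ.prod μ) :=
        fun i => by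
      refine (integrable_const (C * M ^ n * (C * M ^ n))).mono' ?_ (ae_of_all _ fun z => ?_)
      · exact (((hf.comp measurable_fst).mul ((hA_meas i).comp measurable_fst)).mul
          ((hf.comp measurable_snd).mul ((hA_meas i).comp measurable_snd))).aestronglyMeasurable
      · rw [Real.norm_eq_abs, abs_mul, abs_mul, abs_mul]
        have h1 : |f z.1| * |∏ k, v z.1 (i k)| ≤ C * M ^ n :=
          mul_le_mul (hC _) (hAB i _) (abs_nonneg _) ((abs_nonneg (f z.1)).trans (hC z.1))
        have h2 : |f z.2| * |∏ k, v z.2 (i k)| ≤ C * M ^ n :=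
          mul_le_mul (hC _) (hAB i _) (abs_nonneg _) ((abs_nonneg (f z.2)).trans (hC z.2))
        exact mul_le_mul h1 h2 (by positivity) ((by positivity : (0 : ℝ) ≤ |f z.1| * |∏ k, v z.1 (i k)|).trans h1)
    rw [integral_finsetSum _ fun i _ => hint i]
    refine Finset.sum_nonneg fun i _ => ?_
    have hprod := integral_prod_mul (μ := μ) (ν := μ) (fun x => f x * ∏ k, v x (i k)) (fun y => f y * ∏ k, v y (i k))
    rw [hprod]
    exact mul_self_nonneg _
  exact hsum.nonneg hFn

end Literature.Analysis.OperatorTheory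

end
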